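import Mathlib
import HarnessLib

/-!
# Exponent ledger for the literal (fixed-level) embedding of Palasek's super-lacunary
# Obukhov tower — the kernel-checked arithmetic behind `RATE-AUDIT.md`

HONEST FRAMING (cell `ns-blowup`, seat `ns-blowup-instab` = the AUDIT seat, human ruling D-0035):
this cell ATTEMPTS the negative direction of the Clay problem; nothing in this file is a claim
about the Navier–Stokes equations. WHAT THIS IS NOT: not fluid mechanics. Every declaration below
is an identity or inequality between REAL EXPONENTS; the fluid-mechanical meaning of each exponent
(which quantity of the would-be embedded tower it measures) is fixed by the dictionary below and
argued in prose in `run/shared/lean/pub/ns-blowup/instab/RATE-AUDIT.md` (this seat, 2026-08-25).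
The point of kernel-checking them is modest and precise: the audit's verdict lines quote MARGINS
(signs of exponent differences over the whole admissible parameter set), and those signs are what
is proved here — "numbers, not adjectives".

## Dictionary (Palasek arXiv:2605.13827 §2–§3, his rescaling `ν = 1`; TARGET.md §2)

* `b > 1` — lacunarity: `N_k = N_{k-1}^b` (`N_k = N_0^{b^k}`); `β` — amplitude exponent of the
  blow-up state `x_k(0) = A_k = N_k^β` (`x_k ≍ ‖P_k ω‖_∞`); `α ∈ (2, 5/2]` — intermittency.
  VISCOUS admissibility (his (3.2)): `1 < b < α/2`, `max {2b, α-s} < β < α`; in particular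
  `2 < 2b < β < 5/2`.
* Write `N := N_{k-1}`. Host (level `k-1`): vorticity `A_{k-1} = N^β`, scale `N⁻¹`, velocity
  `N^{β-1}`, circulation per structure `Φ_host ≍ N^{β-2}`. Level `k`: vorticity `A_k = N^{bβ}`,
  scale `N^{-b}`, circulation per structure `Γ_k ≍ N^{bβ-2b}`.
* `deficitExp b β = bβ - 2b - (β - 2)` — `log_N (Γ_k / Φ_host)`: how many host-structure fluxes
  ONE level-`k` core of near-maximal vorticity must link (audit §1, Lemma L8.3 / L8.5).
* `windowExp b β = β (b-1)/b` — `log_N` of the level-`k` growth window measured in host turnover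
  times, `A_{k-1}|t_k| = c N^{β(1-1/b)}` (Palasek's `t_k = -c/A_{k-2}`).
* `sheetDeficitExp b β = (b-1)(β-1)` — deficit for one-directional (sheet-like) compression, and
  also `log_N (Y_k/Y_{k-1})` (velocity overshoot of level `k` over its host; audit §3 R4).
* Burgers lock: a flux-importing core held at fixed radius by viscosity sits at the Burgers radius
  `(ν/A_{k-1})^{1/2} = N^{-β/2}`, i.e. at lacunarity `b' = β/2` — exactly where Palasek's strict
  pump-vs-dissipation inequality `β > 2b` becomes an equality (audit §2).
-/

namespace Summit.NavierStokesRegularity.FluidComputer.PalasekTowerExponentLedger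

/-! Notation used in the docstrings (all three are written out explicitly in every statement, so
that the file declares theorems only): `deficitExp b β := bβ - 2b - (β - 2)` (`= (b-1)(β-2)`,
`log_N (Γ_k/Φ_host)`), `windowExp b β := β(b-1)/b` (`log_N` of the window in host turnovers),
`sheetDeficitExp b β := (b-1)(β-1)` (one-directional compression; also `log_N (Y_k/Y_{k-1})`). -/

/-! ## §1 The frozen-in (Kelvin) deficit: R8 of the rate table -/

/-- The deficit exponent factors as `(b-1)(β-2)` (TARGET §2 R8 / derivations D8(iv)). -/
theorem deficitExp_eq (b β : ℝ) : b * β - 2 * b - (β - 2) = (b - 1) * (β - 2) := by ring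

/-- R8, single-episode ceiling: for `b > 1` the deficit is positive iff `β > 2`. -/
theorem deficitExp_pos_iff {b β : ℝ} (hb : 1 < b) : 0 < (b - 1) * (β - 2) ↔ 2 < β := by
  constructor
  · intro h
    by_contra hβ
    have hβ' : β ≤ 2 := not_lt.mp hβ
    have : (b - 1) * (β - 2) ≤ 0 := mul_nonpos_of_nonneg_of_nonpos (by linarith) (by linarith)
    linarith
  · intro hβ
    exact mul_pos (by linarith) (by linarith)

/-- In the VISCOUS admissible range (`β > 2b`, `b > 1`) the deficit is positive with the explicit
margin `2(b-1)² < deficitExp b β`: no single-episode column has a parameter window. -/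
theorem deficitExp_gt_of_viscous {b β : ℝ} (hb : 1 < b) (hβ : 2 * b < β) :
    2 * (b - 1) ^ 2 < (b - 1) * (β - 2) := by nlinarith

/-- Inviscid calibration (audit §1, Remark L8.6): Palasek's INVISCID theorem allows any `β ≤ 2`
(his (3.1) only asks `max{0, α-s} < β < α`), and there the frozen-in deficit is non-positive —
row R8 is void for the Euler tower; it bites only through the viscous constraint `β > 2b`. -/
theorem deficitExp_nonpos_of_le_two {b β : ℝ} (hb : 1 ≤ b) (hβ : β ≤ 2) :
    (b - 1) * (β - 2) ≤ 0 :=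
  mul_nonpos_of_nonneg_of_nonpos (by linarith) (by linarith)

/-- Sheets are worse than tubes: one-directional compression leaves the larger deficit
`(b-1)(β-1) = deficitExp + (b-1)` (derivations D8(ii) "anisotropic is worse"; audit column G-KH). -/
theorem sheetDeficitExp_eq (b β : ℝ) : (b - 1) * (β - 1) = (b - 1) * (β - 2) + (b - 1) := by ring

/-- The sheet deficit / velocity-overshoot exponent is positive as soon as `b > 1`, `β > 1`
(audit §3: a self-advecting level-`k` blob crosses `≍ N^{(b-1)(β-1)}` host cells during its
terminal phase — column G-blob, row R4-translation). -/
theorem sheetDeficitExp_pos {b β : ℝ} (hb : 1 < b) (hβ : 1 < β) : 0 < (b - 1) * (β - 1) :=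
  mul_pos (by linarith) (by linarith)

/-! ## §2 Time is not the obstruction; holding the scale is (R8′ and the Burgers lock) -/

/-- Throughput margin: importing the deficit flux through a host-cell boundary at the host's own
rate (`≍` one host flux per host turnover) needs `≍ N^{deficitExp}` turnovers, and the window holds
`≍ N^{windowExp}` of them; the difference factors as `(b-1)(2 - β(b-1)/b)`. -/
theorem windowExp_sub_deficitExp (b β : ℝ) (hb : b ≠ 0) :
    β * (b - 1) / b - (b - 1) * (β - 2) = (b - 1) * (2 - β * (b - 1) / b) := by
  field_simp; ring

/-- … and is POSITIVE on the whole admissible set (indeed whenever `1 < b`, `0 < β < 2b/(b-1)`,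
which contains `β < 5/2`, `b < 5/4`): flux import is time-feasible (audit §2, R8′(i)). -/
theorem deficitExp_lt_windowExp {b β : ℝ} (hb : 1 < b) (hb' : b < 5 / 4)
    (hβ : β < 5 / 2) : (b - 1) * (β - 2) < β * (b - 1) / b := by
  have hb0 : (0:ℝ) < b := by linarith
  have key : β * (b - 1) / b - (b - 1) * (β - 2) = (b - 1) * (2 - β * (b - 1) / b) :=
    windowExp_sub_deficitExp b β hb0.ne'
  have h2 : 0 < 2 - β * (b - 1) / b := by
    rw [sub_pos, div_lt_iff₀ hb0]; nlinarith
  have : 0 < β * (b - 1) / b - (b - 1) * (β - 2) := by rw [key]; exact mul_pos (by linarith) h2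
  linarith

/-- Burgers lock, arithmetic half. For `N > 1`: level-`k` dissipation `N_k² = N^{2b}` is beaten
by the pump `A_{k-1} = N^β` iff `2b < β` (Palasek's (3.2)); equivalently the Burgers radius
`N^{-β/2}` is STRICTLY finer than the level-`k` scale `N^{-b}`. So a core that holds imported flux
at fixed radius by strain–diffusion balance sits at lacunarity `β/2`, the closed endpoint excluded
by the model (audit §2, R8′(ii)). -/
theorem pump_beats_dissipation_iff {N b β : ℝ} (hN : 1 < N) :
    N ^ (2 * b) < N ^ β ↔ 2 * b < β :=
  Real.rpow_lt_rpow_left_iff hN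

/-- Burgers lock, scale half: under `2b < β` the Burgers radius exponent `-β/2` is strictly below
the level-`k` scale exponent `-b`, with margin `β/2 - b = (β - 2b)/2` — half of Palasek's R1 margin. -/
theorem burgers_radius_finer {N b β : ℝ} (hN : 1 < N) (hβ : 2 * b < β) :
    N ^ (-(β / 2)) < N ^ (-b) := by
  apply Real.rpow_lt_rpow_of_exponent_lt hN; linarith

/-- One host flux squeezed to the Burgers radius reaches the target vorticity `A_k` iff
`β(2-b) > 2` (audit §2, door O-acc): `log_N` of `Φ_host·A_{k-1}/(4πν)` is `2β-2`, of `A_k` is `bβ`. -/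
theorem one_flux_burgers_exponent (b β : ℝ) : 2 * β - 2 - b * β = β * (2 - b) - 2 := by ring

/-- … which inside the admissible set forces `b < 6/5`: for `b ≥ 6/5` even the Burgers accumulator
needs more than one host flux per core. -/
theorem one_flux_burgers_needs_small_b {b β : ℝ} (hβ0 : 0 < β) (hβ : β ≤ 5 / 2)
    (h : 2 < β * (2 - b)) : b < 6 / 5 := by
  by_contra hb
  have hb' : 6 / 5 ≤ b := not_lt.mp hb
  rcases le_or_gt b 2 with h2 | h2
  · have : β * (2 - b) ≤ 5 / 2 * (2 - b) := mul_le_mul_of_nonneg_right hβ (by linarith)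
    linarith
  · have : β * (2 - b) < 0 := mul_neg_of_pos_of_neg hβ0 (by linarith)
    linarith

/-! ## §3 Viscous circulation transfer (Lemma L8.4 of the audit) -/

/-- Crude closure of the viscous Kelvin budget (gradient bound `‖∇ω‖ ≲ N_k x_k`, loop length
`≲ N^{-1}`): the level-`k`-gradient term is dominated iff `β > 3b - 1`. -/
theorem viscous_closure_iff (b β : ℝ) :
    (b - 1) * (β + 1) < b * (β - 2) ↔ 3 * b - 1 < β := by
  constructor <;> intro h <;> linarith

/-- The success region `3b - 1 < β < α ≤ 5/2` of the crude closure is empty once `b ≥ 7/6`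
(honest limit recorded in the audit: for such `b` the viscous term is controlled only under the
extra hypothesis (H-grad) of Lemma L8.4). -/
theorem viscous_closure_empty_of_large_b {b β : ℝ} (hb : 7 / 6 ≤ b) (hβ : β < 5 / 2) :
    ¬ 3 * b - 1 < β := by intro h; linarith

/-- The host-gradient part of the viscous budget is always dominated: `β(1-1/b) < b(β-2)` on the
viscous admissible set, with margin at least `2(b-1)²` (value at `β = 2b`). -/
theorem host_viscous_term_dominated {b β : ℝ} (hb : 1 < b) (hβ : 2 * b < β) :
    β * (1 - 1 / b) < b * (β - 2) := by
  have hb0 : (0:ℝ) < b := by linarith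
  rw [← sub_pos]
  have : b * (β - 2) - β * (1 - 1 / b) = (β * (b ^ 2 - b + 1) - 2 * b ^ 2) / b := by
    field_simp; ring
  rw [this]
  apply div_pos _ hb0
  have h1 : 0 < (β - 2 * b) * (b ^ 2 - b + 1) := mul_pos (by linarith) (by nlinarith)
  have h2 : 0 ≤ b * (b - 1) ^ 2 := mul_nonneg hb0.le (sq_nonneg _)
  nlinarith

/-! ## §4 The Kelvin-critical line of a discrete cascade (derivations D8(vii), door FC) -/

/-- One energy-concentrating step `E' = ηE`, `ℓ' = ℓ/λ` of a packet cascade (`E ≍ U²ℓ³`,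
`ω = U/ℓ`) has `ω'/ω = η^{1/2} λ^{5/2}`; the single-episode Kelvin ceiling per step is `λ²`.
Squared form: `η λ⁵ ≤ λ⁴ ↔ η ≤ 1/λ`. -/
theorem kelvin_step_ceiling_iff {η lam : ℝ} (hl : 0 < lam) :
    η * lam ^ 5 ≤ lam ^ 4 ↔ η ≤ 1 / lam := by
  rw [le_div_iff₀ hl]
  constructor
  · intro h; nlinarith [pow_pos hl 4]
  · intro h; nlinarith [pow_pos hl 4]

/-- … while the Reynolds number grows along the cascade (`Re' = (ηλ)^{1/2} Re`) iff `η > 1/λ`.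
Hence every true-NS packet cascade that beats viscosity scale after scale needs per-step
bundling; `η = 1/λ` (pub-fluidc's machine floor) is exactly the Kelvin-critical, Type-I line. -/
theorem reynolds_grows_iff {η lam : ℝ} (hl : 0 < lam) : 1 < η * lam ↔ 1 / lam < η := by
  rw [div_lt_iff₀ hl]

/-- The two conditions are incompatible except on the critical line: no step has both a strict
Reynolds gain and the single-episode ceiling with room to spare. -/
theorem no_strict_gain_under_ceiling {η lam : ℝ} (hl : 0 < lam)
    (hceil : η * lam ^ 5 ≤ lam ^ 4) (hgain : 1 < η * lam) : False := by
  have h1 : η ≤ 1 / lam := (kelvin_step_ceiling_iff hl).1 hceil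
  have h2 : 1 / lam < η := (reynolds_grows_iff hl).1 hgain
  linarith

/-! ## §5 Inventory: how much host flux a whole level consumes (audit §4, R9∧R8) -/

/-- Per host cell, level `k` has `≍ N^{(b-1)(5-2α)}` cores (intermittency dimension `5-2α`), each
linking `≍ N^{deficitExp}` host fluxes; the total exponent `(b-1)(β+3-2α)` is positive on the
admissible set (`β > 2 ≥ 2α - 3`), so host flux must be RE-USED (one strand threading many cores). -/
theorem level_overdraws_host {b β α : ℝ} (hb : 1 < b) (hβ : 2 < β) (hα : α ≤ 5 / 2) :
    0 < (b - 1) * (β - 2) + (b - 1) * (5 - 2 * α) := by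
  have : (b - 1) * (β - 2) + (b - 1) * (5 - 2 * α) = (b - 1) * (β + 3 - 2 * α) := by ring
  rw [this]; exact mul_pos (by linarith) (by linarith)

/-! ## §6 Door O-acc: the Burgers-accumulator tower sits at Palasek's margin (audit §6) -/

/-- At the marginal lacunarity `b = β/2` the frozen-in deficit `(b-1)(β-2)` equals `(β-2)²/2`:
the number of host turnovers an accumulator must be fed co-signed flux (audit §6.3 (P1)). -/
theorem deficitExp_at_marginal (β : ℝ) : (β / 2 - 1) * (β - 2) = (β - 2) ^ 2 / 2 := by ring

/-- At `b = β/2` the window exponent `β(b-1)/b` equals `β - 2` (audit §6.2). -/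
theorem windowExp_at_marginal {β : ℝ} (hβ : β ≠ 0) : β * (β / 2 - 1) / (β / 2) = β - 2 := by
  field_simp

/-- Exponent window of the accumulator tower (audit §6.2): a throughput-fed Burgers level reaches
`log_N ω = 3β - 4` within its host's window and must hit the target `bβ = β²/2`; this closes iff
`β² - 6β + 8 < 0`, i.e. exactly for `2 < β < 4`. -/
theorem accumulator_window_iff (β : ℝ) : β ^ 2 - 6 * β + 8 < 0 ↔ 2 < β ∧ β < 4 := by
  have h : β ^ 2 - 6 * β + 8 = (β - 2) * (β - 4) := by ring
  rw [h]
  constructor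
  · intro hneg
    rcases lt_trichotomy β 2 with h2 | h2 | h2
    · exact absurd hneg (not_lt.mpr (mul_nonneg_of_nonpos_of_nonpos (by linarith) (by linarith)))
    · subst h2; simp at hneg
    · refine ⟨h2, ?_⟩
      by_contra h4
      exact absurd hneg (not_lt.mpr (mul_nonneg (by linarith) (by linarith [not_lt.mp h4])))
  · rintro ⟨h2, h4⟩
    exact mul_neg_of_pos_of_neg (by linarith) (by linarith)

/-- … equivalently the slack `3β - 4 - β²/2` is positive on `(2, 4)`; on Palasek's `β ≤ 5/2` it is
at most `3/8` (value at `β = 5/2`), so the co-signedness efficiency may decay at most like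
`N^{-3/8}` per level (audit §6.2). -/
theorem accumulator_slack_pos {β : ℝ} (h2 : 2 < β) (h4 : β < 4) : 0 < 3 * β - 4 - β ^ 2 / 2 := by
  nlinarith

/-- The slack is increasing on `β ≤ 3`, hence bounded by its value `3/8` at `β = 5/2` on Palasek's
range. -/
theorem accumulator_slack_le {β : ℝ} (hβ : β ≤ 5 / 2) : 3 * β - 4 - β ^ 2 / 2 ≤ 3 / 8 := by
  nlinarith [sq_nonneg (β - 5 / 2)]

/-! ## §6.6–§6.7 (audit v1.4, g3): delivery windows, the unsteadiness floor, energy at the margin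

Marginal schedule `N_k := ½ N_{k-1}^{β/2}` (`N_k² = ¼ A_{k-1}`), `N := N_{k-1}`: window
`(c/4) N^{β-2}` host turnovers; fluxes to deliver `m_k = 4·2^{-β} N^{d₁}`, `d₁ = (β-2)²/2`
(`deficitExp_at_marginal`). The statements below are the exponent comparisons quoted in
`RATE-AUDIT.md` §6.6.3 (e)(f) and §6.7 (MARGIN-LEG ML1.2–1.4 re-checked). -/

/-- Marginal window count: the host's window holds `(c/4)N^{β-2}` of its own turnovers, an
exponent positive exactly for `β > 2` (audit 6.6.0, MARGIN-LEG ML1.2). -/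
theorem marginal_window_exp_pos_iff (β : ℝ) : 0 < β - 2 ↔ 2 < β := by
  constructor <;> intro h <;> linarith

/-- Random-sign delivery (audit 6.5 (ii)(b), ML1.4): a `√`-law walk reaches `N^{d₁}` host fluxes
after `N^{2d₁} = N^{(β-2)²}` turnovers, inside the window `N^{β-2}` iff `(β-2)² < β-2`, i.e. exactly
for `2 < β < 3`. -/
theorem randomWalk_window_iff (β : ℝ) : (β - 2) ^ 2 < β - 2 ↔ 2 < β ∧ β < 3 := by
  constructor
  · intro h
    have h2 : 2 < β := by nlinarith [sq_nonneg (β - 2)]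
    exact ⟨h2, by nlinarith⟩
  · rintro ⟨h2, h3⟩
    nlinarith

/-- Coherent (designed-sign) delivery (ML1.3–1.4): `N^{d₁}` fluxes at one per turnover need
`d₁ = (β-2)²/2 < β-2`, i.e. `2 < β < 4` — the accumulator window of `accumulator_window_iff`. -/
theorem coherent_window_iff (β : ℝ) : (β - 2) ^ 2 / 2 < β - 2 ↔ 2 < β ∧ β < 4 := by
  constructor
  · intro h
    have h2 : 2 < β := by nlinarith [sq_nonneg (β - 2)]
    exact ⟨h2, by nlinarith⟩
  · rintro ⟨h2, h4⟩
    nlinarith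

/-- Unsteadiness floor (audit 6.6.3 (e)): with delivery efficiency `χ ≤ C·ε` (steady hosts deliver
nothing, stagnation-point identities R12′), the accumulator needs `ε ≳ N^{d₁-(β-2)}`; the exponent
by which `ε` may decay, `(β-2) - (β-2)²/2`, factors as `(β-2)(4-β)/2`. -/
theorem unsteadiness_floor_eq (β : ℝ) : (β - 2) - (β - 2) ^ 2 / 2 = (β - 2) * (4 - β) / 2 := by
  ring

/-- … and is positive exactly on the accumulator window `2 < β < 4` (`= 0.32` at `β = 2.4`). -/
theorem unsteadiness_floor_pos {β : ℝ} (h2 : 2 < β) (h4 : β < 4) : 0 < (β - 2) * (4 - β) / 2 := by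
  have := mul_pos (sub_pos.mpr h2) (sub_pos.mpr h4)
  linarith

/-- Viscous delivery shortfall (audit 6.6.3 (f)): a steady Navier–Stokes host delivers at
efficiency `≲ Re⁻¹ = N^{2-β}`; over the window `N^{β-2}` this gives exponent `(2-β) + (β-2) = 0`
host fluxes — short of the target `d₁ = (β-2)²/2`, which is positive whenever `β ≠ 2`. -/
theorem viscous_delivery_shortfall {β : ℝ} (hβ : β ≠ 2) :
    (2 - β) + (β - 2) < (β - 2) ^ 2 / 2 := by
  have h0 : (2 - β) + (β - 2) = 0 := by ring
  have hsq : 0 < (β - 2) ^ 2 := by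
    rcases lt_or_gt_of_ne hβ with h | h
    · have := mul_pos (sub_pos.mpr h) (sub_pos.mpr h); nlinarith
    · have := mul_pos (sub_pos.mpr h) (sub_pos.mpr h); nlinarith
  rw [h0]
  linarith

/-- ENERGY AT THE MARGIN, R13 (audit 6.7.1–6.7.2): a marginal Burgers level spanning its host's
stretching segment has kinetic energy `≳ N^{β²-2β-1}`; level energies are summable only if this
exponent is negative, which for `β ≥ 0` (Palasek: `β > 2`) means exactly `β < 1 + √2 = 2.414…`. -/
theorem tube_energy_exponent_neg_iff {β : ℝ} (hβ : 0 ≤ β) :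
    β ^ 2 - 2 * β - 1 < 0 ↔ β < 1 + Real.sqrt 2 := by
  have hs : Real.sqrt 2 * Real.sqrt 2 = 2 := Real.mul_self_sqrt (by norm_num)
  have hs0 : 0 < Real.sqrt 2 := Real.sqrt_pos.mpr (by norm_num)
  constructor
  · intro h
    by_contra hge
    -- `β - 1 ≥ √2 > 0`, so `(β - 1)² ≥ 2`, contradicting `β² - 2β - 1 = (β-1)² - 2 < 0`
    have h1 : Real.sqrt 2 ≤ β - 1 := by linarith [not_lt.mp hge]
    have h2 : Real.sqrt 2 * Real.sqrt 2 ≤ (β - 1) * (β - 1) :=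
      mul_le_mul h1 h1 hs0.le (by linarith)
    nlinarith
  · intro hlt
    -- `|β - 1| < √2`
    rcases le_or_gt 1 β with h1 | h1
    · have ha : 0 ≤ β - 1 := by linarith
      have hb : β - 1 < Real.sqrt 2 := by linarith
      have h2 : (β - 1) * (β - 1) < Real.sqrt 2 * Real.sqrt 2 :=
        mul_lt_mul'' hb hb ha ha
      nlinarith
    · nlinarith

/-- Palasek's intermittency exponent dictated by the tube geometry (audit 6.7.1): matching
`X_k² = N_k^{2(β-α)}` with the tube energy `N_k^{2β-4-2/β}` forces `α = 2 + 1/β`. -/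
theorem alphaEff_tube {β α : ℝ} (_hβ : β ≠ 0) :
    2 * (β - α) = 2 * β - 4 - 2 / β ↔ α = 2 + 1 / β := by
  constructor
  · intro h
    linear_combination (-1 / 2 : ℝ) * h
  · intro h
    subst h
    ring

/-- Child/parent energy ratio at the margin (audit 6.7.2 cross-check): `E_k/E_{k-1} ≍ m_k² N^{2/β-1}`
has exponent `(β-2)² + 2/β - 1 = (β²-2β-1)(β-2)/β` — the same root `1 + √2`. -/
theorem energy_ratio_factor {β : ℝ} (hβ : β ≠ 0) :
    (β - 2) ^ 2 + 2 / β - 1 = (β ^ 2 - 2 * β - 1) * (β - 2) / β := by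
  field_simp
  ring

/-- The energy window `(2, 1 + √2)` of N1* is non-empty … -/
theorem energy_window_nonempty : (2 : ℝ) < 1 + Real.sqrt 2 := by
  have := Real.one_lt_sqrt_two
  linarith

/-- … and lies inside the random-walk window `β < 3` (so `randomWalk_window_iff` is automatic on it)
and inside Palasek's `β < 5/2`. -/
theorem energy_window_lt : 1 + Real.sqrt 2 < (5 / 2 : ℝ) := by
  have : Real.sqrt 2 < 3 / 2 := (Real.sqrt_lt' (by norm_num)).mpr (by norm_num)
  linarith

/-- On the energy window every previously recorded constraint of N1* holds at once: accumulator
window (`2 < β < 4`), random-sign feasibility (`β < 3`), unsteadiness floor positive, energy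
exponent negative. -/
theorem marginal_tower_window {β : ℝ} (h2 : 2 < β) (hE : β < 1 + Real.sqrt 2) :
    β ^ 2 - 6 * β + 8 < 0 ∧ (β - 2) ^ 2 < β - 2 ∧ 0 < (β - 2) * (4 - β) / 2 ∧
      β ^ 2 - 2 * β - 1 < 0 := by
  have h52 : β < 5 / 2 := lt_trans hE energy_window_lt
  refine ⟨(accumulator_window_iff β).mpr ⟨h2, by linarith⟩,
    (randomWalk_window_iff β).mpr ⟨h2, by linarith⟩,
    unsteadiness_floor_pos h2 (by linarith),
    (tube_energy_exponent_neg_iff (by linarith)).mpr hE⟩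

end Summit.NavierStokesRegularity.FluidComputer.PalasekTowerExponentLedger
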